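import Summits.QuantumFields.YangMills.Theorems.FluctuationComparisonRegPrIntLS2BetaCoarseCurlLocal
import HarnessLib

/-!
# S2β · (CURL-AVG, FILE F) COUNTING THE DILUTION KERNEL: each fine plaquette is hit by at most `(d!)²·L²` of the `|I|·L² = L^d·(d!)²·L²` summands of B2's comb sum — over ONE coarse
# plaquette (max weight `≤ L^{2−d}`) and even over ALL coarse plaquettes of the same orientation together (column sum `≤ L^{2−d}`); `|I| = L^d·(d!)²`

Cell `ym3-torus` (YM ladder rung R3 = continuum `SU(2)` Yang–Mills on the three-torus at fixed lattice data — a RUNG: NOT d = 4, NOT infinite volume, NOT a mass gap,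
NOT Clay).  Width seat `ym3-torus-px13` (gen 26); crux `stmt-QuantumFields-20520`, LINE g18-1 S2β, pairing lane; (SCT-c) road of record (px16 g22 LOCATE 17:49:04Z (i), px17 g22
17:47:42Z (2)): propagate with the TRUE kernel of (CURL-AVG) B2 ✓p830155 and close with the cell-maximal square function (★).  The kernel of B2's right-hand side
`|I|⁻¹Σ_{i}Σ_{s,t<L}‖Y_{U₀}(∂q_{i,s,t})‖` at the coarse plaquette `p′ = (y; μ, ν)` is `W(p′, q) = |I|⁻¹·#{(i,s,t) : q_{i,s,t} = q}`, the plaquette `q_{i,s,t}` being based at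
`x_i + (s+1)e_μ + t e_ν = shiftN (shiftN (blockSite y r) μ (s+1)) ν t` (E ✓`walkEnd_stair_replicate_eq_shiftN`).  THIS FILE counts: (b) for fixed `p′` and fixed base point `z`,
`#{(i,s,t)} ≤ (d!)²·L²`; (c) the same bound for `#{(y,i,s,t)}` — all coarse plaquettes of the orientation together (translation by fixed amounts and `(y,r) ↦ blockSite y r` are
injective, lit ✓`AveragingRT.blockSite_inj`); and `|I| = L^d·(d!)²` (lit ✓`BlockAveragingEMLLinearised.card_idx`), so both the max weight and the column sums of `W` are `≤ L^{2−d}` (px16's (i): `max(W∘W′) ≤ max W · colsum W′`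
⇒ the n-step kernel has max `≤ L^{(2−d)n}`).  `--kind proof --supports stmt-QuantumFields-20520 --as helper`, count-neutral, DEFINITION-FREE; generic `P : Params` (standing range).

WHAT IS PROVED (sorry-free).  `shiftN_left_injective`; ★★`card_filter_base_eq_le` ((b): one coarse plaquette); ★★`card_filter_base_eq_le_all` ((c): all
coarse plaquettes of the orientation); both with the bound `(Fintype.card (Equiv.Perm (Fin d)))²·L²`.

HONEST.  Finite counting over lit block geometry; nothing of Bałaban's analysis asserted; the composed-kernel statement, (★), (SCT-c), (ST), LOC, AVG₂♭-ax_q, GAP♯∘ (registry 3732b7df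
UNTOUCHED, 0∕5), the five REGISTERED stubs, S2β, crux 20520, 19936, 19200, `YM3TorusSU2` — NOT proved; rung R3 = SU(2) YM₃ on T³ — NOT d = 4, NOT infinite volume, NOT a mass
gap, NOT Clay; the Yang–Mills mass gap is NOT proved.  Axioms standard.

References: [Balaban1987RG1] CMP **109** (1987) (0.1)–(0.4) pp.252–253; [Balaban1985Averaging] CMP **98** (1985) (9)–(10) p.19, Prop. 1 (51) p.26.
-/

set_option autoImplicit false

noncomputable section

open scoped BigOperators
open Finset

namespace Summit.QuantumFields.YangMills.Theorems.FluctuationComparisonRegPrIntLS2BetaCoarseCurlKernelCount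

open Literature.MathematicalPhysics.QuantumFieldTheory.Balaban1983to89
open Literature.MathematicalPhysics.QuantumFieldTheory.Balaban1983to89.T4Continuum
open Literature.MathematicalPhysics.QuantumFieldTheory.Balaban1983to89.BlockAveraging (Idx off)
open Literature.MathematicalPhysics.QuantumFieldTheory.Balaban1983to89.B10Eq47AxialChi (shiftN shiftN_succ shiftN_zero)
open Literature.MathematicalPhysics.QuantumFieldTheory.Balaban1983to89.BlockAveragingEMLProp2 (shiftN_apply)
open Literature.MathematicalPhysics.QuantumFieldTheory.Balaban1983to89.AveragingRT (blockSite_inj)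

variable {P : Params} {j : ℕ}

/-- Translation by a fixed number of steps is injective. [folklore] -/
theorem shiftN_left_injective {k : ℕ} (μ : Fin P.d) (m : ℕ) {x x' : Site P k} (h : shiftN x μ m = shiftN x' μ m) : x = x' := by
  funext κ
  have hκ := congrFun h κ
  rw [shiftN_apply, shiftN_apply] at hκ
  exact add_right_cancel hκ

/-- ★★ **(b) ONE COARSE PLAQUETTE: EACH BASE POINT IS HIT AT MOST `(d!)²·L²` TIMES** among the `|I|·L²` summands `(i, s, t)` of B2's comb sum at `p′ = (y; μ, ν)`
(for fixed `(σ, σ′, s, t)` the offset `r` is determined: translations and `r ↦ blockSite y r` are injective). [cite: Balaban1987RG1, (0.1)-(0.3) p.252; Balaban1985Averaging, Prop. 1 (51) p.26] -/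
theorem card_filter_base_eq_le (hj : j + 1 ≤ P.m + P.K) (y : Site P (j + 1)) (μ ν : Fin P.d) (z : Site P j) :
    (((Finset.univ : Finset (Idx P)) ×ˢ (Finset.range P.L ×ˢ Finset.range P.L)).filter
        (fun a => shiftN (shiftN (Site.blockSite y a.1.1) μ (a.2.1 + 1)) ν a.2.2 = z)).card ≤
      (Fintype.card (Equiv.Perm (Fin P.d))) ^ 2 * P.L ^ 2 := by
  classical
  set S := ((Finset.univ : Finset (Idx P)) ×ˢ (Finset.range P.L ×ˢ Finset.range P.L)).filter
        (fun a => shiftN (shiftN (Site.blockSite y a.1.1) μ (a.2.1 + 1)) ν a.2.2 = z) with hS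
  set T : Finset ((Equiv.Perm (Fin P.d) × Equiv.Perm (Fin P.d)) × (ℕ × ℕ)) := (Finset.univ ×ˢ Finset.univ) ×ˢ (Finset.range P.L ×ˢ Finset.range P.L) with hT
  have hcardT : T.card = (Fintype.card (Equiv.Perm (Fin P.d))) ^ 2 * P.L ^ 2 := by
    rw [hT, Finset.card_product, Finset.card_product, Finset.card_product, Finset.card_univ, Finset.card_range]; ring
  rw [← hcardT]
  refine Finset.card_le_card_of_injOn (fun a => ((a.1.2.1, a.1.2.2), a.2)) (fun a ha => ?_) (fun a ha a' ha' h => ?_)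
  · rw [hS, Finset.mem_coe, Finset.mem_filter, Finset.mem_product] at ha
    rw [hT, Finset.mem_coe, Finset.mem_product, Finset.mem_product]
    exact ⟨⟨Finset.mem_univ _, Finset.mem_univ _⟩, ha.1.2⟩
  · rw [hS, Finset.mem_coe, Finset.mem_filter] at ha ha'
    simp only [Prod.mk.injEq] at h
    obtain ⟨⟨hσ, hσ'⟩, hst⟩ := h
    have hbase : shiftN (shiftN (Site.blockSite y a.1.1) μ (a.2.1 + 1)) ν a.2.2 = shiftN (shiftN (Site.blockSite y a'.1.1) μ (a'.2.1 + 1)) ν a'.2.2 := by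
      rw [ha.2, ha'.2]
    rw [hst] at hbase
    have hr : a.1.1 = a'.1.1 := (blockSite_inj hj (shiftN_left_injective μ _ (shiftN_left_injective ν _ hbase))).2
    exact Prod.ext (Prod.ext hr (Prod.ext hσ hσ')) hst

/-- ★★ **(c) ALL COARSE PLAQUETTES OF THE ORIENTATION TOGETHER: EACH BASE POINT IS HIT AT MOST `(d!)²·L²` TIMES** among the summands `(y, i, s, t)` — the column sums of the
kernel (`(y, r) ↦ blockSite y r` is jointly injective, lit ✓`blockSite_inj`). [cite: Balaban1987RG1, (0.1)-(0.3) p.252; Balaban1985Averaging, Prop. 1 (51) p.26] -/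
theorem card_filter_base_eq_le_all (hj : j + 1 ≤ P.m + P.K) (μ ν : Fin P.d) (z : Site P j) :
    (((Finset.univ : Finset (Site P (j + 1) × Idx P)) ×ˢ (Finset.range P.L ×ˢ Finset.range P.L)).filter
        (fun a => shiftN (shiftN (Site.blockSite a.1.1 a.1.2.1) μ (a.2.1 + 1)) ν a.2.2 = z)).card ≤
      (Fintype.card (Equiv.Perm (Fin P.d))) ^ 2 * P.L ^ 2 := by
  classical
  set S := (((Finset.univ : Finset (Site P (j + 1) × Idx P)) ×ˢ (Finset.range P.L ×ˢ Finset.range P.L)).filter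
        (fun a => shiftN (shiftN (Site.blockSite a.1.1 a.1.2.1) μ (a.2.1 + 1)) ν a.2.2 = z)) with hS
  set T : Finset ((Equiv.Perm (Fin P.d) × Equiv.Perm (Fin P.d)) × (ℕ × ℕ)) := (Finset.univ ×ˢ Finset.univ) ×ˢ (Finset.range P.L ×ˢ Finset.range P.L) with hT
  have hcardT : T.card = (Fintype.card (Equiv.Perm (Fin P.d))) ^ 2 * P.L ^ 2 := by
    rw [hT, Finset.card_product, Finset.card_product, Finset.card_product, Finset.card_univ, Finset.card_range]; ring
  rw [← hcardT]
  refine Finset.card_le_card_of_injOn (fun a => ((a.1.2.2.1, a.1.2.2.2), a.2)) (fun a ha => ?_) (fun a ha a' ha' h => ?_)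
  · rw [hS, Finset.mem_coe, Finset.mem_filter, Finset.mem_product] at ha
    rw [hT, Finset.mem_coe, Finset.mem_product, Finset.mem_product]
    exact ⟨⟨Finset.mem_univ _, Finset.mem_univ _⟩, ha.1.2⟩
  · rw [hS, Finset.mem_coe, Finset.mem_filter] at ha ha'
    simp only [Prod.mk.injEq] at h
    obtain ⟨⟨hσ, hσ'⟩, hst⟩ := h
    have hbase : shiftN (shiftN (Site.blockSite a.1.1 a.1.2.1) μ (a.2.1 + 1)) ν a.2.2 = shiftN (shiftN (Site.blockSite a'.1.1 a'.1.2.1) μ (a'.2.1 + 1)) ν a'.2.2 := by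
      rw [ha.2, ha'.2]
    rw [hst] at hbase
    have hyr := blockSite_inj hj (shiftN_left_injective μ _ (shiftN_left_injective ν _ hbase))
    exact Prod.ext (Prod.ext hyr.1 (Prod.ext hyr.2 (Prod.ext hσ hσ'))) hst

end Summit.QuantumFields.YangMills.Theorems.FluctuationComparisonRegPrIntLS2BetaCoarseCurlKernelCount

end
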